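import Literature.NumberTheory.ComplexMultiplication.CMOrderConductorNorm
import Mathlib.GroupTheory.Perm.Cycle.Type
import HarnessLib

/-!
# `p ∣ [𝓞_K : 𝔯] ⟺ 𝔯 is singular above p` for an arbitrary order `𝔯`

Layer A3 of the Hodge/CM programme (docs/m5/MAPPING.md §1), the "arbitrary order" series (`𝔯 = endOrder ρ ⊆ 𝓞_K`,
conductor `𝔣 = EndOrder.conductor ρ`, `𝔣_𝔯 = conductorIdeal ρ`, index `[𝓞_K : 𝔯] = (toRingOfIntegers ρ).range.toAddSubgroup.index`).
Stevenhagen calls `𝔯` *singular above* `p` when some prime `𝔭 ∋ p` of `𝔯` is singular, i.e. not invertible, i.e.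
`𝔣_𝔯 ⊆ 𝔭` (`CMOrderRegularPrimes.not_isUnit_coeIdeal_iff_conductorIdeal_le`); otherwise *regular above* `p` (= `p`-maximal).
`CMOrderDiscriminant.dvd_index_of_conductorIdeal_le` is the printed half «singular above `p` ⟹ `p ∣ [𝒪 : R]`»; here the
converse, from `[𝓞_K : 𝔯] ∣ N(𝔣)` (`CMOrderConductorNorm.index_dvd_absNorm_conductor`) and CAUCHY'S THEOREM in `𝓞_K/𝔣`:

* §1 `sup_span_natCast_ne_top_of_dvd_absNorm` — an ideal `I ≠ 0` of `𝓞_K` with `p ∣ N(I)` is not coprime to `p`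
  (were `I + (p) = (1)`, multiplication by `p` would be onto, hence injective, on the finite group `𝓞_K/I`, against an
  element of order `p`); `exists_isMaximal_conductor_le_of_dvd_index` (`p ∣ [𝓞_K : 𝔯] ⟹` a prime `𝔓 ⊇ 𝔣 + (p)` of `𝓞_K`).
* §2 **`exists_isPrime_conductorIdeal_le_of_dvd_index`** (`p ∣ [𝓞_K : 𝔯] ⟹ ∃ 𝔭 ⊇ 𝔣_𝔯`, `p ∈ 𝔭`, prime of `𝔯`),
  **`dvd_index_iff_exists_isPrime_conductorIdeal_le`** («`p ∣ [𝒪_K : R] ⟺ R` is singular above `p`»),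
  `dvd_index_iff_exists_not_isUnit` (the same with «singular» = «not invertible»), and the contrapositive
  **`isUnit_coeIdeal_of_not_dvd_index`** («if `p ∤ [𝒪_K : R]`, every prime of `R` above `p` is regular» — `R` is
  `p`-maximal).
* §3 `exists_isPrime_conductorIdeal_le_of_dvd_absNorm_conductor`, **`dvd_absNorm_conductor_iff_dvd_index`** (`p ∣ N(𝔣) ⟺
  p ∣ [𝓞_K : 𝔯]`), **`primeFactors_absNorm_conductor_eq`**,
  **`setOf_prime_singular_eq_primeFactors_index`** (the rational primes above which `𝔯` is singular are the prime factors
  of the index; `finite_setOf_prime_singular`), `absNorm_conductor_dvd_index_pow` (`[𝓞_K : 𝔯] ∣ N(𝔣) ∣ [𝓞_K : 𝔯]^{[K:ℚ]}`).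

Theorems only (no new definitions, no named facts).

## References
* [Stevenhagen2008NumberRings] P. Stevenhagen, *The arithmetic of number rings*, MSRI Publ. 44 (2008) — §6 («the singular
  primes `𝔭`, which divide `𝔣_R` and in particular the index `[𝒪 : R]`»), p. 224; §8 («factoring `p` in `𝒪_K` or `ℤ[α]`
  is 'the same' as long as `p` does not divide the index … the order is called `p`-maximal or regular above `p`»), p. 231,
  («if `ℤ[α]` is singular above `p`, then `p` divides the index»), p. 233, and Thm. 8.5 (proof), p. 236.
-/

noncomputable section

open scoped Classical nonZeroDivisors NumberField
open NumberField Module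

namespace Literature.NumberTheory.ComplexMultiplication

namespace EndOrder

section SingularIndex

variable {K : Type} [Field K] [NumberField K]
variable {ι : Type} [Fintype ι] [DecidableEq ι] [Nonempty ι] {ρ : K →ₐ[ℚ] Matrix ι ι ℚ}

omit [Fintype ι] [DecidableEq ι] [Nonempty ι] in
/-- An ideal `I` of `𝓞_K` of finite index with `p ∣ N(I)` is not coprime to `p`: `I + (p) ≠ (1)` (Cauchy's theorem in
`𝓞_K/I`). [cite: Stevenhagen2008NumberRings, §7 («every prime `𝔭 ⊇ I` divides the index `[R : I]`»), p. 230] -/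
theorem sup_span_natCast_ne_top_of_dvd_absNorm {I : Ideal (𝓞 K)} (hI : Ideal.absNorm I ≠ 0) {p : ℕ} (hp : p.Prime)
    (hdvd : p ∣ Ideal.absNorm I) : I ⊔ Ideal.span {(p : 𝓞 K)} ≠ ⊤ := by
  haveI : Finite (𝓞 K ⧸ I) := (Ideal.absNorm_ne_zero_iff I).1 hI
  haveI : Fact p.Prime := ⟨hp⟩
  intro htop
  -- multiplication by `p` is onto `𝓞_K / I`
  have hsurj : Function.Surjective fun y : 𝓞 K ⧸ I => p • y := by
    intro y
    obtain ⟨a, rfl⟩ := Ideal.Quotient.mk_surjective y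
    obtain ⟨i, hi, c, hc, h1⟩ := Submodule.mem_sup.1 ((Ideal.eq_top_iff_one _).1 htop)
    obtain ⟨b, rfl⟩ := Ideal.mem_span_singleton'.1 hc
    refine ⟨Ideal.Quotient.mk I (a * b), ?_⟩
    change p • Ideal.Quotient.mk I (a * b) = Ideal.Quotient.mk I a
    have ha : a = a * i + p * (a * b) := by
      calc a = a * (i + b * p) := by rw [h1, mul_one]
        _ = a * i + p * (a * b) := by ring
    rw [nsmul_eq_mul, ← map_natCast (Ideal.Quotient.mk I), ← map_mul, ha, map_add,
      Ideal.Quotient.eq_zero_iff_mem.2 (I.mul_mem_left a hi), zero_add, ← ha]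
  -- hence injective; but there is an element of order `p`
  have hinj : Function.Injective fun y : 𝓞 K ⧸ I => p • y := Finite.injective_iff_surjective.2 hsurj
  have hcard : p ∣ Nat.card (𝓞 K ⧸ I) := by rwa [Ideal.absNorm_apply, Submodule.cardQuot_apply] at hdvd
  obtain ⟨x, hx⟩ := exists_prime_addOrderOf_dvd_card' p hcard
  have hx0 : x ≠ 0 := fun h => hp.one_lt.ne' (by rw [← hx, h, addOrderOf_zero])
  have hpx : p • x = 0 := by rw [← hx]; exact addOrderOf_nsmul_eq_zero x
  refine hx0 (hinj ?_)
  change p • x = p • (0 : 𝓞 K ⧸ I)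
  rw [hpx, nsmul_zero]

/-- **`p ∣ [𝓞_K : 𝔯] ⟹` some prime `𝔓` of `𝓞_K` contains `𝔣` and `p`** (`[𝓞_K : 𝔯] ∣ N(𝔣)`, then §1).
[cite: Stevenhagen2008NumberRings, §6, p. 224; §8, pp. 231–233] -/
theorem exists_isMaximal_conductor_le_of_dvd_index {p : ℕ} (hp : p.Prime)
    (hdvd : p ∣ (toRingOfIntegers ρ).range.toAddSubgroup.index) :
    ∃ 𝔓 : Ideal (𝓞 K), 𝔓.IsMaximal ∧ EndOrder.conductor ρ ≤ 𝔓 ∧ (p : 𝓞 K) ∈ 𝔓 := by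
  have h0 : Ideal.absNorm (EndOrder.conductor ρ) ≠ 0 := fun h => conductor_ne_bot ρ (Ideal.absNorm_eq_zero_iff.1 h)
  obtain ⟨𝔓, h𝔓, hle⟩ := Ideal.exists_le_maximal _
    (sup_span_natCast_ne_top_of_dvd_absNorm h0 hp (hdvd.trans (index_dvd_absNorm_conductor (ρ := ρ))))
  exact ⟨𝔓, h𝔓, le_sup_left.trans hle, hle (Submodule.mem_sup_right (Ideal.mem_span_singleton_self _))⟩

/-- **`p ∣ [𝓞_K : 𝔯] ⟹ 𝔯` is singular above `p`**: some prime `𝔭 ∋ p` of `𝔯` contains the conductor `𝔣_𝔯`.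
[cite: Stevenhagen2008NumberRings, §8 («as long as `p` does not divide the index … regular above `p`»), p. 231; §6, p. 224] -/
theorem exists_isPrime_conductorIdeal_le_of_dvd_index {p : ℕ} (hp : p.Prime)
    (hdvd : p ∣ (toRingOfIntegers ρ).range.toAddSubgroup.index) :
    ∃ 𝔭 : Ideal (endOrder ρ), 𝔭.IsPrime ∧ conductorIdeal ρ ≤ 𝔭 ∧ (p : endOrder ρ) ∈ 𝔭 := by
  obtain ⟨𝔓, h𝔓, hle, hp𝔓⟩ := exists_isMaximal_conductor_le_of_dvd_index (ρ := ρ) hp hdvd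
  refine ⟨𝔓.comap (toRingOfIntegers ρ), h𝔓.isPrime.comap _, Ideal.comap_mono hle, ?_⟩
  rw [Ideal.mem_comap, map_natCast]
  exact hp𝔓

/-- **«`p ∣ [𝒪_K : R] ⟺ R` is singular above `p`»** — with «singular prime» = «prime containing the conductor».
[cite: Stevenhagen2008NumberRings, §8, pp. 231, 233, Thm. 8.5 (proof) p. 236; §6, p. 224] -/
theorem dvd_index_iff_exists_isPrime_conductorIdeal_le {p : ℕ} (hp : p.Prime) :
    p ∣ (toRingOfIntegers ρ).range.toAddSubgroup.index ↔
      ∃ 𝔭 : Ideal (endOrder ρ), 𝔭.IsPrime ∧ conductorIdeal ρ ≤ 𝔭 ∧ (p : endOrder ρ) ∈ 𝔭 :=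
  ⟨exists_isPrime_conductorIdeal_le_of_dvd_index hp, fun ⟨_, h𝔭, hle, hp𝔭⟩ =>
    dvd_index_of_conductorIdeal_le h𝔭 hle hp hp𝔭⟩

/-- The same with «singular» read as «not invertible» (Stevenhagen's definition of a singular prime).
[cite: Stevenhagen2008NumberRings, §5 Prop. 5.4, p. 220; §6, p. 224; §8, p. 231] -/
theorem dvd_index_iff_exists_not_isUnit [IsFractionRing (endOrder ρ) K] {p : ℕ} (hp : p.Prime) :
    p ∣ (toRingOfIntegers ρ).range.toAddSubgroup.index ↔
      ∃ 𝔭 : Ideal (endOrder ρ), 𝔭.IsPrime ∧ ¬ IsUnit (𝔭 : FractionalIdeal (endOrder ρ)⁰ K) ∧ (p : endOrder ρ) ∈ 𝔭 := by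
  rw [dvd_index_iff_exists_isPrime_conductorIdeal_le hp]
  have hp0 : (p : endOrder ρ) ≠ 0 := by exact_mod_cast hp.ne_zero
  constructor
  · rintro ⟨𝔭, h𝔭, hle, hp𝔭⟩
    have h0 : 𝔭 ≠ ⊥ := fun h => hp0 ((Submodule.eq_bot_iff _).1 h _ hp𝔭)
    exact ⟨𝔭, h𝔭, (not_isUnit_coeIdeal_iff_conductorIdeal_le h𝔭 h0).2 hle, hp𝔭⟩
  · rintro ⟨𝔭, h𝔭, hsing, hp𝔭⟩
    have h0 : 𝔭 ≠ ⊥ := fun h => hp0 ((Submodule.eq_bot_iff _).1 h _ hp𝔭)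
    exact ⟨𝔭, h𝔭, (not_isUnit_coeIdeal_iff_conductorIdeal_le h𝔭 h0).1 hsing, hp𝔭⟩

/-- **«If `p ∤ [𝒪_K : R]`, then `R` is regular above `p`»** (`p`-maximal): every prime of `𝔯` containing `p` is
invertible. [cite: Stevenhagen2008NumberRings, §8, p. 231] -/
theorem isUnit_coeIdeal_of_not_dvd_index [IsFractionRing (endOrder ρ) K] {p : ℕ} (hp : p.Prime)
    (hndvd : ¬ p ∣ (toRingOfIntegers ρ).range.toAddSubgroup.index) {𝔭 : Ideal (endOrder ρ)} (h𝔭 : 𝔭.IsPrime)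
    (hp𝔭 : (p : endOrder ρ) ∈ 𝔭) : IsUnit (𝔭 : FractionalIdeal (endOrder ρ)⁰ K) := by
  by_contra hsing
  exact hndvd ((dvd_index_iff_exists_not_isUnit hp).2 ⟨𝔭, h𝔭, hsing, hp𝔭⟩)

/-- … and no prime of `𝔯` above such a `p` contains the conductor. [cite: Stevenhagen2008NumberRings, §8, p. 231; §6, p. 224] -/
theorem not_conductorIdeal_le_of_not_dvd_index {p : ℕ} (hp : p.Prime)
    (hndvd : ¬ p ∣ (toRingOfIntegers ρ).range.toAddSubgroup.index) {𝔭 : Ideal (endOrder ρ)} (h𝔭 : 𝔭.IsPrime)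
    (hp𝔭 : (p : endOrder ρ) ∈ 𝔭) : ¬ conductorIdeal ρ ≤ 𝔭 := fun hle =>
  hndvd (dvd_index_of_conductorIdeal_le h𝔭 hle hp hp𝔭)

end SingularIndex

/-! ## §3 `p ∣ N(𝔣) ⟺ p ∣ [𝓞_K : 𝔯]`: the singular rational primes are the prime factors of the index, `[𝓞_K : 𝔯] ∣ N(𝔣) ∣ [𝓞_K : 𝔯]^{[K:ℚ]}` -/

section SingularIndexNorm

variable {K : Type} [Field K] [NumberField K]
variable {ι : Type} [Fintype ι] [DecidableEq ι] [Nonempty ι] {ρ : K →ₐ[ℚ] Matrix ι ι ℚ}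

/-- `p ∣ N(𝔣) ⟹ 𝔯` is singular above `p` (a prime `𝔓 ⊇ 𝔣 + (p)` of `𝓞_K` contracts to a prime `𝔭 ∋ p` of `𝔯` containing
`𝔣_𝔯`). [cite: Stevenhagen2008NumberRings, §6 («the singular primes `𝔭`, which divide `𝔣_R`»), p. 224; §7, p. 230] -/
theorem exists_isPrime_conductorIdeal_le_of_dvd_absNorm_conductor {p : ℕ} (hp : p.Prime)
    (hdvd : p ∣ Ideal.absNorm (EndOrder.conductor ρ)) :
    ∃ 𝔭 : Ideal (endOrder ρ), 𝔭.IsPrime ∧ conductorIdeal ρ ≤ 𝔭 ∧ (p : endOrder ρ) ∈ 𝔭 := by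
  have h0 : Ideal.absNorm (EndOrder.conductor ρ) ≠ 0 := fun h => conductor_ne_bot ρ (Ideal.absNorm_eq_zero_iff.1 h)
  obtain ⟨𝔓, h𝔓, hle⟩ := Ideal.exists_le_maximal _ (sup_span_natCast_ne_top_of_dvd_absNorm h0 hp hdvd)
  refine ⟨𝔓.comap (toRingOfIntegers ρ), h𝔓.isPrime.comap _, Ideal.comap_mono (le_sup_left.trans hle), ?_⟩
  rw [Ideal.mem_comap, map_natCast]
  exact hle (Submodule.mem_sup_right (Ideal.mem_span_singleton_self _))

/-- **`p ∣ N(𝔣) ⟺ p ∣ [𝓞_K : 𝔯]`**: the norm of the conductor and the index of an order have the same prime divisors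
(`[𝓞_K : 𝔯] ∣ N(𝔣)`; conversely `p ∣ N(𝔣) ⟹` singular above `p ⟹ p ∣ [𝓞_K : 𝔯]`). [cite: Stevenhagen2008NumberRings, §6
(«… divide `𝔣_R` and in particular the index `[𝒪 : R]`»), p. 224; §8 Thm. 8.5 (proof), p. 236] -/
theorem dvd_absNorm_conductor_iff_dvd_index {p : ℕ} (hp : p.Prime) :
    p ∣ Ideal.absNorm (EndOrder.conductor ρ) ↔ p ∣ (toRingOfIntegers ρ).range.toAddSubgroup.index :=
  ⟨fun h => by
    obtain ⟨𝔭, h𝔭, hle, hp𝔭⟩ := exists_isPrime_conductorIdeal_le_of_dvd_absNorm_conductor (ρ := ρ) hp h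
    exact dvd_index_of_conductorIdeal_le h𝔭 hle hp hp𝔭,
    fun h => h.trans (index_dvd_absNorm_conductor (ρ := ρ))⟩

/-- **The prime factors of `N(𝔣)` are the prime factors of `[𝓞_K : 𝔯]`** (the rational primes above which `𝔯` is
singular). [cite: Stevenhagen2008NumberRings, §6, p. 224; §8, pp. 231–236] -/
theorem primeFactors_absNorm_conductor_eq :
    (Ideal.absNorm (EndOrder.conductor ρ)).primeFactors = ((toRingOfIntegers ρ).range.toAddSubgroup.index).primeFactors := by
  have h0 : Ideal.absNorm (EndOrder.conductor ρ) ≠ 0 := fun h => conductor_ne_bot ρ (Ideal.absNorm_eq_zero_iff.1 h)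
  ext p
  rw [Nat.mem_primeFactors_of_ne_zero h0, Nat.mem_primeFactors_of_ne_zero (index_range_toRingOfIntegers_ne_zero (ρ := ρ))]
  exact ⟨fun ⟨hp, h⟩ => ⟨hp, (dvd_absNorm_conductor_iff_dvd_index hp).1 h⟩,
    fun ⟨hp, h⟩ => ⟨hp, (dvd_absNorm_conductor_iff_dvd_index hp).2 h⟩⟩

/-- **The rational primes above which `𝔯` is singular are exactly the prime factors of `[𝓞_K : 𝔯]`** (in particular
finitely many). [cite: Stevenhagen2008NumberRings, §8, pp. 231, 233, Thm. 8.5 p. 236] -/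
theorem setOf_prime_singular_eq_primeFactors_index :
    {p : ℕ | p.Prime ∧ ∃ 𝔭 : Ideal (endOrder ρ), 𝔭.IsPrime ∧ conductorIdeal ρ ≤ 𝔭 ∧ (p : endOrder ρ) ∈ 𝔭} =
      ↑((toRingOfIntegers ρ).range.toAddSubgroup.index).primeFactors := by
  ext p
  rw [Set.mem_setOf_eq, Finset.mem_coe, Nat.mem_primeFactors_of_ne_zero (index_range_toRingOfIntegers_ne_zero (ρ := ρ))]
  exact ⟨fun ⟨hp, h⟩ => ⟨hp, (dvd_index_iff_exists_isPrime_conductorIdeal_le hp).2 h⟩,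
    fun ⟨hp, h⟩ => ⟨hp, (dvd_index_iff_exists_isPrime_conductorIdeal_le hp).1 h⟩⟩

/-- `𝔯` is singular above only finitely many rational primes. [cite: Stevenhagen2008NumberRings, §6 («an order has only
finitely many singular primes»), p. 224] -/
theorem finite_setOf_prime_singular :
    {p : ℕ | p.Prime ∧ ∃ 𝔭 : Ideal (endOrder ρ), 𝔭.IsPrime ∧ conductorIdeal ρ ≤ 𝔭 ∧ (p : endOrder ρ) ∈ 𝔭}.Finite := by
  rw [setOf_prime_singular_eq_primeFactors_index (ρ := ρ)]
  exact Finset.finite_toSet _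

/-- **`N(𝔣) ∣ [𝓞_K : 𝔯]^{[K:ℚ]}`** (`[𝓞_K : 𝔯] ∈ 𝔣`, `CMOrderConductor.index_mem_conductor`, and `N((m)) = m^{[K:ℚ]}`);
with `[𝓞_K : 𝔯] ∣ N(𝔣)` (`CMOrderConductorNorm`) the two numbers have the same support.
[cite: Stevenhagen2008NumberRings, §6 («… and in particular the index `[𝒪 : R]`»), p. 224] -/
theorem absNorm_conductor_dvd_index_pow :
    Ideal.absNorm (EndOrder.conductor ρ) ∣ (toRingOfIntegers ρ).range.toAddSubgroup.index ^ Module.finrank ℚ K := by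
  have h := Ideal.absNorm_dvd_absNorm_of_le
    ((Ideal.span_singleton_le_iff_mem (I := EndOrder.conductor ρ)).2 (index_mem_conductor ρ))
  rwa [Ideal.absNorm_span_singleton, ← map_natCast (algebraMap ℤ (𝓞 K)), Algebra.norm_algebraMap, RingOfIntegers.rank,
    Int.natAbs_pow, Int.natAbs_natCast] at h

end SingularIndexNorm

end EndOrder

end Literature.NumberTheory.ComplexMultiplication
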